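import Mathlib
import HarnessLib
import Literature.NumberTheory.DiophantineGeometry.SquarefulSumsConics
import Literature.NumberTheory.DiophantineGeometry.ConicParametrisationCount
import Literature.NumberTheory.DiophantineGeometry.ConicGlobalWeight
import Literature.NumberTheory.DiophantineGeometry.ConicHeightForm
import Literature.NumberTheory.DiophantineGeometry.ConicBasePoint
import Literature.NumberTheory.DiophantineGeometry.ConicSignCount
import Literature.NumberTheory.DiophantineGeometry.SquarefulSumsSummand
import Literature.Algebra.EuclideanLattices.CoprimeLatticePointsEllipse
import Literature.NumberTheory.LFunctions.MoebiusCoprimeSum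

/-!
# Sums of three squareful numbers: the lower bound `N₁(B) ≥ (1 - ε) c √B`

A sorry-free proof of `SquarefulSumLowerBound` (`SquarefulSums.lean`), i.e. of Theorem 1 of

* T. D. Browning, K. Van Valckenborgh, *Sums of three squareful numbers*, Experimental
  Mathematics 21 (2012), 204–211, [cite: BrowningValckenborgh2012, Theorem 1, (1.1), §§2–3].

## The printed proof and how it is followed

§3 of the paper writes every squareful solution of `x₀ + x₁ = x₂` uniquely as
`xᵢ = uᵢ² yᵢ³` with `μ²(y₀y₁y₂) = 1` (our `conicTriples`, file `SquarefulSumsConics`), drops all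
but finitely many conics `C_y : y₀³x₀² + y₁³x₁² = y₂³x₂²`, and for each conic with a rational
point invokes the asymptotic `N_{C_y,H_y}(B) ~ ¼ c_{H_y}(C_y(𝔸_ℚ)⁺) B` for the anticanonical
height `H_y` (Franke–Manin–Tschinkel / Peyre), the constant being computed in §2
(Lemmas 1–2 for the local densities, (2.10)–(2.12) for `α`, the real density and the final
product, giving `c_y = π⁻¹ · bvvSummand y`).

The reduction to finitely many conics is `squarefulSumLowerBound_of_conic`
(`SquarefulSumsConics`).  Mathlib has no Manin–Peyre asymptotic for conics, so the per-conic
count `conic_lower_bound` below is proved directly, by the classical route which the local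
density computation of §2 mirrors:

1. (`ConicBasePoint`) Legendre's theorem (through the tree's Hasse–Minkowski for ternary forms)
   gives a primitive zero `P` of `aX² + bY² - cZ²` ((a,b,c) = y, `abc` square-free) with `Z > 0`
   under the solubility conditions, which hold whenever `bvvSummand y ≠ 0`
   (`SquarefulSumsSummand`).
2. (`ConicParametrisationAlgebra/Count`) Completing `P` to a unimodular basis `(P, e₁, e₂)`,
   the secant map `v ↦ Ψ(v) = primPart (conicMap A P (v₁e₁ + v₂e₂))` is an exactly `2 : 1` map
   from coprime pairs onto the primitive zeros up to sign (`ncard_param_eq`); the `8` sign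
   changes are counted in `ConicSignCount`.
3. (`ConicHeightForm`) In these coordinates the `Z`-coordinate is a positive definite binary
   quadratic form of discriminant `-4ab`, so the height condition is an ellipse.
4. (`ConicChartLocal`, `ConicLocalDensities`, `ConicGlobalWeight`) The conditions
   `y₀ ∣ X, y₁ ∣ Y, y₂ ∣ Z` on `Ψ(v)` and the content of `conicMap` depend only on `v` modulo
   `M = ∏_{p ∣ 2abc} p²`; the number of admissible classes, weighted by the content, is
   `16 ∏_{odd p ∣ abc} 2p²(p - 1)` (`sum_globalWeight_eq`) — the counterpart of Lemmas 1–2.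
5. (`Literature.Algebra.EuclideanLattices.CoprimeLatticePointsEllipse`) Coprime lattice points
   in a residue class of an expanding ellipse are counted with constant
   `(2π/√D) M⁻² Σ_{(d,M)=1} μ(d)/d²`, and `Literature.NumberTheory.LFunctions.MoebiusCoprimeSum`
   evaluates the sum as `(6/π²) ∏_{p ∣ M} (1 - p⁻²)⁻¹`.
6. (this file) Summing over the admissible classes gives `#conicTriples y B ≥ (c_y - ε) √B`
   with `c_y = π⁻¹ · bvvSummand y` (`peyre_constant_identity`, the computation (2.1)/(2.12) of
   the paper), and `SquarefulSumLowerBound_holds` follows from the reduction.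

Only the lower bound is needed, so points of non-admissible content are simply discarded and
no uniformity in `y` is required.
-/

noncomputable section

namespace Literature.NumberTheory.DiophantineGeometry


open Filter Topology Finset
open Literature.Algebra.EuclideanLattices

/-! ### Primitive zeros with a vanishing coordinate -/

/-- If `k² ∣ n` with `n` a square-free natural number then `k = ±1`. [folklore] -/
theorem eq_one_or_neg_one_of_sq_dvd_squarefree {n : ℕ} (hn : Squarefree n) {k : ℤ}
    (hk : k ^ 2 ∣ (n : ℤ)) : k = 1 ∨ k = -1 := by
  have hn' : Squarefree (n : ℤ) := Int.squarefree_natCast.2 hn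
  have hu : IsUnit k := hn' k (by rw [← sq]; exact hk)
  exact Int.isUnit_iff.1 hu

/-- From `u k² = w m²` with `gcd(k, m) = 1`: `k² ∣ w`. [folklore] -/
theorem sq_dvd_of_mul_sq_eq {u w k m : ℤ} (h : u * k ^ 2 = w * m ^ 2) (hkm : Int.gcd k m = 1) :
    k ^ 2 ∣ w := by
  have hcop : IsCoprime (k ^ 2) (m ^ 2) := (Int.isCoprime_iff_gcd_eq_one.2 hkm).pow
  exact hcop.dvd_of_dvd_mul_right ⟨u, by linear_combination -h⟩

/-- A primitive zero of `a X² + b Y² - c Z²` (`abc` square-free) with a vanishing coordinate has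
all its coordinates in `{0, 1, -1}`. [folklore] -/
theorem coords_of_primitive_zero_of_coord_eq_zero {a b c : ℕ} (hd : Squarefree (a * b * c))
    {x : ℤ × ℤ × ℤ} (hx : ternForm ((a : ℤ), (b : ℤ), -(c : ℤ)) x = 0) (hxc : content3 x = 1)
    (h0 : x.1 = 0 ∨ x.2.1 = 0 ∨ x.2.2 = 0) :
    (x.1 = 0 ∨ x.1 = 1 ∨ x.1 = -1) ∧ (x.2.1 = 0 ∨ x.2.1 = 1 ∨ x.2.1 = -1) ∧
      (x.2.2 = 0 ∨ x.2.2 = 1 ∨ x.2.2 = -1) := by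
  obtain ⟨X, Y, Z⟩ := x
  simp only [ternForm] at hx
  simp only at h0 ⊢
  rw [content3_apply] at hxc
  simp only at hxc
  have habc : a * b * c ≠ 0 := hd.ne_zero
  have ha : a ≠ 0 := by rintro rfl; simp at habc
  have hb : b ≠ 0 := by rintro rfl; simp at habc
  have hc : c ≠ 0 := by rintro rfl; simp at habc
  have hbsq : Squarefree b := (Squarefree.of_mul_left hd).of_mul_right
  have hasq : Squarefree a := (Squarefree.of_mul_left hd).of_mul_left
  have hcsq : Squarefree c := Squarefree.of_mul_right hd
  rcases h0 with hX | hY | hZ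
  · -- `X = 0`: `b Y² = c Z²`
    subst hX
    have hYZ : Int.gcd Y Z = 1 := by simpa [Int.gcd_zero_left] using hxc
    have heq : (b : ℤ) * Y ^ 2 = (c : ℤ) * Z ^ 2 := by linear_combination hx
    have hY : Y = 1 ∨ Y = -1 :=
      eq_one_or_neg_one_of_sq_dvd_squarefree hcsq (sq_dvd_of_mul_sq_eq heq hYZ)
    have hZ : Z = 1 ∨ Z = -1 :=
      eq_one_or_neg_one_of_sq_dvd_squarefree hbsq
        (sq_dvd_of_mul_sq_eq heq.symm (by rw [Int.gcd_comm]; exact hYZ))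
    exact ⟨Or.inl rfl, Or.inr hY, Or.inr hZ⟩
  · -- `Y = 0`: `a X² = c Z²`
    subst hY
    have hXZ : Int.gcd X Z = 1 := by
      have h := hxc
      simp only [Int.gcd_zero_left] at h
      simpa [Int.gcd, Int.natAbs_abs] using h
    have heq : (a : ℤ) * X ^ 2 = (c : ℤ) * Z ^ 2 := by linear_combination hx
    have hX : X = 1 ∨ X = -1 :=
      eq_one_or_neg_one_of_sq_dvd_squarefree hcsq (sq_dvd_of_mul_sq_eq heq hXZ)
    have hZ : Z = 1 ∨ Z = -1 :=
      eq_one_or_neg_one_of_sq_dvd_squarefree hasq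
        (sq_dvd_of_mul_sq_eq heq.symm (by rw [Int.gcd_comm]; exact hXZ))
    exact ⟨Or.inr hX, Or.inl rfl, Or.inr hZ⟩
  · -- `Z = 0`: `a X² + b Y² = 0` forces `X = Y = 0`, contradicting primitivity
    subst hZ
    have heq : (a : ℤ) * X ^ 2 + (b : ℤ) * Y ^ 2 = 0 := by linear_combination hx
    have ha' : (0 : ℤ) < a := by exact_mod_cast Nat.pos_of_ne_zero ha
    have hb' : (0 : ℤ) < b := by exact_mod_cast Nat.pos_of_ne_zero hb
    have hX : X = 0 := by nlinarith [sq_nonneg X, sq_nonneg Y, mul_pos ha' hb']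
    have hY : Y = 0 := by nlinarith [sq_nonneg X, sq_nonneg Y, mul_pos ha' hb']
    subst hX; subst hY
    simp at hxc

/-- The set of primitive zeros of `a X² + b Y² - c Z²` with a vanishing coordinate is finite.
[folklore] -/
theorem finite_primitive_zero_coord_eq_zero {a b c : ℕ} (hd : Squarefree (a * b * c)) :
    {x : ℤ × ℤ × ℤ | ternForm ((a : ℤ), (b : ℤ), -(c : ℤ)) x = 0 ∧ content3 x = 1 ∧
      (x.1 = 0 ∨ x.2.1 = 0 ∨ x.2.2 = 0)}.Finite := by
  set U : Set ℤ := {0, 1, -1} with hU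
  have hUf : U.Finite := by rw [hU]; exact Set.toFinite _
  refine ((hUf.prod (hUf.prod hUf))).subset ?_
  rintro ⟨X, Y, Z⟩ ⟨hx, hxc, h0⟩
  obtain ⟨h1, h2, h3⟩ := coords_of_primitive_zero_of_coord_eq_zero hd hx hxc h0
  simp only [Set.mem_prod, hU, Set.mem_insert_iff, Set.mem_singleton_iff]
  exact ⟨h1, h2, h3⟩

/-- `|u| ≤ B` once `k u² ≤ B` with `k ≥ 1`. [folklore] -/
theorem mem_Icc_of_mul_sq_le {k u : ℤ} (hk : 1 ≤ k) {B : ℕ} (h : k * u ^ 2 ≤ B) :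
    u ∈ Set.Icc (-(B : ℤ)) B := by
  have hu2 : u ^ 2 ≤ B := by nlinarith [sq_nonneg u]
  have habs : |u| ≤ u ^ 2 := by
    rw [Int.abs_eq_natAbs]; exact Int.natAbs_le_self_sq u
  exact Set.mem_Icc.2 (abs_le.1 (habs.trans hu2))

/-- The signed solutions of height `≤ B` form a finite set. [folklore] -/
theorem finite_signedSolutions {a b c : ℕ} (hd : Squarefree (a * b * c)) (B : ℕ) :
    {x : ℤ × ℤ × ℤ | ternForm ((a : ℤ), (b : ℤ), -(c : ℤ)) x = 0 ∧ content3 x = 1 ∧ x.1 ≠ 0 ∧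
        x.2.1 ≠ 0 ∧ x.2.2 ≠ 0 ∧ (a : ℤ) ∣ x.1 ∧ (b : ℤ) ∣ x.2.1 ∧ (c : ℤ) ∣ x.2.2 ∧
        (c : ℤ) * x.2.2 ^ 2 ≤ B}.Finite := by
  have habc : a * b * c ≠ 0 := hd.ne_zero
  have ha : (1 : ℤ) ≤ a := by
    exact_mod_cast Nat.pos_of_ne_zero (by rintro rfl; simp at habc)
  have hb : (1 : ℤ) ≤ b := by
    exact_mod_cast Nat.pos_of_ne_zero (by rintro rfl; simp at habc)
  have hc : (1 : ℤ) ≤ c := by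
    exact_mod_cast Nat.pos_of_ne_zero (by rintro rfl; simp at habc)
  refine ((Set.finite_Icc (-(B : ℤ)) B).prod
    ((Set.finite_Icc (-(B : ℤ)) B).prod (Set.finite_Icc (-(B : ℤ)) B))).subset ?_
  rintro ⟨X, Y, Z⟩ ⟨hx, -, -, -, -, -, -, -, hB⟩
  simp only [ternForm] at hx
  simp only at hB
  have heq : (a : ℤ) * X ^ 2 + (b : ℤ) * Y ^ 2 = (c : ℤ) * Z ^ 2 := by linear_combination hx
  have hX2 : (a : ℤ) * X ^ 2 ≤ B := by nlinarith [sq_nonneg Y]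
  have hY2 : (b : ℤ) * Y ^ 2 ≤ B := by nlinarith [sq_nonneg X]
  simp only [Set.mem_prod]
  exact ⟨mem_Icc_of_mul_sq_le ha hX2, mem_Icc_of_mul_sq_le hb hY2, mem_Icc_of_mul_sq_le hc hB⟩

/-! ### Fibres of the parametrisation -/

variable {A P e₁ e₂ : ℤ × ℤ × ℤ}

/-- The coprime preimage of a finite set under the parametrisation is finite (the
parametrisation is at most `2`-to-`1` on coprime vectors, `param_inj`). [folklore] -/
theorem finite_coprime_preimage_param (hA0 : A.1 ≠ 0) (hA1 : A.2.1 ≠ 0) (hA2 : A.2.2 ≠ 0)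
    (hP : ternForm A P = 0) (he : idet3 P e₁ e₂ = 1) {S : Set (ℤ × ℤ × ℤ)} (hS : S.Finite) :
    {v : ℤ × ℤ | Int.gcd v.1 v.2 = 1 ∧ primPart (conicMap A P (v.1 • e₁ + v.2 • e₂)) ∈ S}.Finite := by
  have hsub : {v : ℤ × ℤ | Int.gcd v.1 v.2 = 1 ∧ primPart (conicMap A P (v.1 • e₁ + v.2 • e₂)) ∈ S} ⊆
      ⋃ x ∈ S, {v : ℤ × ℤ | Int.gcd v.1 v.2 = 1 ∧
        primPart (conicMap A P (v.1 • e₁ + v.2 • e₂)) = x} := by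
    intro v hv
    simp only [Set.mem_iUnion, Set.mem_setOf_eq, exists_prop]
    exact ⟨_, hv.2, hv.1, rfl⟩
  refine (hS.biUnion fun x _ => ?_).subset hsub
  by_cases hex : ∃ v₀ : ℤ × ℤ, Int.gcd v₀.1 v₀.2 = 1 ∧
      primPart (conicMap A P (v₀.1 • e₁ + v₀.2 • e₂)) = x
  · obtain ⟨v₀, hv₀, hv₀x⟩ := hex
    refine (Set.toFinite ({v₀, -v₀} : Set (ℤ × ℤ))).subset ?_
    intro v hv
    have h := param_inj hA0 hA1 hA2 hP he hv₀ hv.1 (Or.inl (by rw [hv₀x, hv.2]))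
    simp only [Set.mem_insert_iff, Set.mem_singleton_iff]
    exact h
  · convert Set.finite_empty
    ext v
    simp only [Set.mem_setOf_eq, Set.mem_empty_iff_false, iff_false, not_and]
    intro hv hvx
    exact hex ⟨v, hv, hvx⟩

/-! ### Counting with disjoint classes -/

/-- If finitely many pairwise disjoint sets `C i` (`i ∈ I`) all lie in a finite set `T`, then
`∑ #C i ≤ #T`. [folklore] -/
theorem sum_ncard_le_of_disjoint {ι α : Type*} (I : Finset ι) (C : ι → Set α)
    (hdisj : ∀ i ∈ I, ∀ j ∈ I, i ≠ j → Disjoint (C i) (C j)) {T : Set α} (hT : T.Finite)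
    (hsub : ∀ i ∈ I, C i ⊆ T) : ∑ i ∈ I, (C i).ncard ≤ T.ncard := by
  classical
  have hfin : ∀ i ∈ I, (C i).Finite := fun i hi => hT.subset (hsub i hi)
  set F : ι → Finset α := fun i => if h : i ∈ I then (hfin i h).toFinset else ∅ with hF
  have hFi : ∀ i (hi : i ∈ I), F i = (hfin i hi).toFinset := fun i hi => by simp [hF, hi]
  have hcard : ∀ i ∈ I, (F i).card = (C i).ncard := by
    intro i hi
    rw [hFi i hi, Set.ncard_eq_toFinset_card _ (hfin i hi)]
  have hdisj' : (I : Set ι).PairwiseDisjoint F := by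
    intro i hi j hj hne
    rw [Function.onFun, hFi i hi, hFi j hj, Set.Finite.disjoint_toFinset]
    exact hdisj i hi j hj hne
  calc ∑ i ∈ I, (C i).ncard = ∑ i ∈ I, (F i).card := Finset.sum_congr rfl fun i hi => (hcard i hi).symm
    _ = (I.biUnion F).card := (Finset.card_biUnion hdisj').symm
    _ ≤ hT.toFinset.card := by
        refine Finset.card_le_card fun t ht => ?_
        simp only [Finset.mem_biUnion, Set.Finite.mem_toFinset] at ht ⊢
        obtain ⟨i, hi, hti⟩ := ht
        rw [hFi i hi, Set.Finite.mem_toFinset] at hti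
        exact hsub i hi hti
    _ = T.ncard := (Set.ncard_eq_toFinset_card _ hT).symm

/-! ### Two analytic lemmas -/

/-- Rescaling a linear-growth asymptotic `N(T)/T → κ` along `T = w √B`. [folklore] -/
theorem tendsto_div_sqrt_of_tendsto_div {N : ℝ → ℝ} {κ w : ℝ} (hw : 0 < w)
    (h : Tendsto (fun T : ℝ => N T / T) atTop (𝓝 κ)) :
    Tendsto (fun B : ℕ => N (w * Real.sqrt B) / Real.sqrt B) atTop (𝓝 (κ * w)) := by
  have hT : Tendsto (fun B : ℕ => w * Real.sqrt (B : ℝ)) atTop atTop := by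
    refine Tendsto.const_mul_atTop hw ?_
    exact Real.tendsto_sqrt_atTop.comp tendsto_natCast_atTop_atTop
  have h1 : Tendsto (fun B : ℕ => N (w * Real.sqrt B) / (w * Real.sqrt B) * w) atTop (𝓝 (κ * w)) :=
    (h.comp hT).mul_const w
  refine h1.congr' ?_
  filter_upwards [Filter.eventually_gt_atTop 0] with B hB
  have hsq : 0 < Real.sqrt (B : ℝ) := Real.sqrt_pos.2 (by exact_mod_cast hB)
  field_simp

/-- From `v(B)/√B → 8 L` and `v(B) ≤ 8 u(B) + K`: eventually `(L - ε) √B ≤ u(B)`. [folklore] -/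
theorem eventually_lower_bound {u v : ℕ → ℝ} {L : ℝ} (K : ℝ)
    (hv : Tendsto (fun B : ℕ => v B / Real.sqrt B) atTop (𝓝 (8 * L)))
    (h : ∀ B, v B ≤ 8 * u B + K) {ε : ℝ} (hε : 0 < ε) :
    ∀ᶠ B : ℕ in atTop, (L - ε) * Real.sqrt B ≤ u B := by
  have hK : Tendsto (fun B : ℕ => K / Real.sqrt B) atTop (𝓝 0) :=
    tendsto_const_nhds.div_atTop (Real.tendsto_sqrt_atTop.comp tendsto_natCast_atTop_atTop)
  have h2 : Tendsto (fun B : ℕ => v B / Real.sqrt B - K / Real.sqrt B) atTop (𝓝 (8 * L - 0)) :=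
    hv.sub hK
  rw [sub_zero] at h2
  have h3 : ∀ᶠ B : ℕ in atTop, 8 * L - 8 * ε < v B / Real.sqrt B - K / Real.sqrt B :=
    h2.eventually (eventually_gt_nhds (by linarith))
  filter_upwards [h3, Filter.eventually_gt_atTop 0] with B hB hB0
  have hsq : 0 < Real.sqrt (B : ℝ) := Real.sqrt_pos.2 (by exact_mod_cast hB0)
  rw [← sub_div, lt_div_iff₀ hsq] at hB
  nlinarith [h B]





/-! ### Points of an admissible class parametrise solutions -/

/-- **Piece inclusion.** For a coprime `v` whose class has non-zero weight `W` and with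
`Z(v) ≤ (W/√c) √B`, the primitive point `Ψ(v)` is either a signed solution of height `≤ B`
(`a ∣ X`, `b ∣ Y`, `c ∣ Z`, `c Z² ≤ B`) or a primitive zero with a vanishing coordinate.
[cite: BrowningValckenborgh2012, §3 (the passage to N_{H_y}(B^{1/2}))] -/
theorem param_mem_of_intWeight_ne_zero {a b c : ℕ} {P e₁ e₂ : ℤ × ℤ × ℤ}
    (hd : Squarefree (a * b * c)) (hP : ternForm (coeffs a b c) P = 0) (hPc : content3 P = 1)
    (he : idet3 P e₁ e₂ = 1) (hγ : 0 < P.2.2)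
    (h8a : 2 ∣ a → (8 : ℤ) ∣ (b : ℤ) - c) (h8b : 2 ∣ b → (8 : ℤ) ∣ (a : ℤ) - c)
    (h8c : 2 ∣ c → (8 : ℤ) ∣ (a : ℤ) + b)
    {v : ℤ × ℤ} (hv : Int.gcd v.1 v.2 = 1) (hW : intWeight a b c P e₁ e₂ v ≠ 0) {B : ℕ}
    (hB : ((conicMap (coeffs a b c) P (v.1 • e₁ + v.2 • e₂)).2.2 : ℝ) ≤
      (intWeight a b c P e₁ e₂ v : ℝ) / Real.sqrt c * Real.sqrt B) :
    primPart (conicMap (coeffs a b c) P (v.1 • e₁ + v.2 • e₂)) ∈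
        {x : ℤ × ℤ × ℤ | ternForm ((a : ℤ), (b : ℤ), -(c : ℤ)) x = 0 ∧ content3 x = 1 ∧ x.1 ≠ 0 ∧
          x.2.1 ≠ 0 ∧ x.2.2 ≠ 0 ∧ (a : ℤ) ∣ x.1 ∧ (b : ℤ) ∣ x.2.1 ∧ (c : ℤ) ∣ x.2.2 ∧
          (c : ℤ) * x.2.2 ^ 2 ≤ B} ∨
      primPart (conicMap (coeffs a b c) P (v.1 • e₁ + v.2 • e₂)) ∈
        {x : ℤ × ℤ × ℤ | ternForm ((a : ℤ), (b : ℤ), -(c : ℤ)) x = 0 ∧ content3 x = 1 ∧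
          (x.1 = 0 ∨ x.2.1 = 0 ∨ x.2.2 = 0)} := by
  have habc : a * b * c ≠ 0 := hd.ne_zero
  have ha : a ≠ 0 := by rintro rfl; simp at habc
  have hb : b ≠ 0 := by rintro rfl; simp at habc
  have hc : c ≠ 0 := by rintro rfl; simp at habc
  have hA0 : (coeffs a b c).1 ≠ 0 := by simp [coeffs, ha]
  have hA1 : (coeffs a b c).2.1 ≠ 0 := by simp [coeffs, hb]
  have hA2 : (coeffs a b c).2.2 ≠ 0 := by simp [coeffs, hc]
  have hA0' : 0 < (coeffs a b c).1 := by
    simp only [coeffs]; exact_mod_cast Nat.pos_of_ne_zero ha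
  have hA1' : 0 < (coeffs a b c).2.1 := by
    simp only [coeffs]; exact_mod_cast Nat.pos_of_ne_zero hb
  have hst : ¬(v.1 = 0 ∧ v.2 = 0) := by
    rintro ⟨h1, h2⟩; rw [h1, h2] at hv; simp at hv
  set X := conicMap (coeffs a b c) P (v.1 • e₁ + v.2 • e₂) with hX
  have hX0 : X ≠ 0 := conicMap_comb_ne_zero hA0 hA1 hA2 hP he hst
  have hXz : ternForm (coeffs a b c) X = 0 := ternForm_conicMap hP _
  have hprim0 : ternForm ((a : ℤ), (b : ℤ), -(c : ℤ)) (primPart X) = 0 :=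
    ternForm_primPart_eq_zero hX0 hXz
  have hprim1 : content3 (primPart X) = 1 := content3_primPart hX0
  obtain ⟨hWg, haX, hbX, hcX⟩ := intWeight_facts hd hP hPc he h8a h8b h8c hv hW
  by_cases h0 : (primPart X).1 = 0 ∨ (primPart X).2.1 = 0 ∨ (primPart X).2.2 = 0
  · exact Or.inr ⟨hprim0, hprim1, h0⟩
  left
  push Not at h0
  refine ⟨hprim0, hprim1, h0.1, h0.2.1, h0.2.2, haX, hbX, hcX, ?_⟩
  -- the height condition
  set g : ℕ := content3 X with hg
  have hg0 : 0 < g := Nat.pos_of_ne_zero fun h => hX0 ((content3_eq_zero_iff X).1 h)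
  have hWle : intWeight a b c P e₁ e₂ v ≤ g := Nat.le_of_dvd hg0 hWg
  have hW0 : (0 : ℝ) < intWeight a b c P e₁ e₂ v := by exact_mod_cast Nat.pos_of_ne_zero hW
  have hZpos : 0 < X.2.2 := zForm_pos hP he hA0' hA1' hγ hst
  obtain ⟨-, -, hgZ⟩ := content3_dvd X
  set Zq : ℤ := X.2.2 / (g : ℤ) with hZq
  have hZq_eq : (Zq : ℝ) = (X.2.2 : ℝ) / (g : ℝ) := by
    rw [hZq, Int.cast_div hgZ (by exact_mod_cast hg0.ne')]; push_cast; rfl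
  have hc0 : (0 : ℝ) < c := by exact_mod_cast Nat.pos_of_ne_zero hc
  have hsc : 0 < Real.sqrt c := Real.sqrt_pos.2 hc0
  have hZq_le : (Zq : ℝ) ≤ Real.sqrt B / Real.sqrt c := by
    rw [hZq_eq]
    calc (X.2.2 : ℝ) / (g : ℝ) ≤ (X.2.2 : ℝ) / (intWeight a b c P e₁ e₂ v : ℝ) := by
          apply div_le_div_of_nonneg_left (by exact_mod_cast hZpos.le) hW0
          exact_mod_cast hWle
      _ ≤ Real.sqrt B / Real.sqrt c := by
          rw [div_le_iff₀ hW0]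
          calc (X.2.2 : ℝ) ≤ (intWeight a b c P e₁ e₂ v : ℝ) / Real.sqrt c * Real.sqrt B := hB
            _ = Real.sqrt B / Real.sqrt c * (intWeight a b c P e₁ e₂ v : ℝ) := by ring
  have hZq0 : (0 : ℝ) ≤ Zq := by
    rw [hZq_eq]; positivity
  have hreal : (c : ℝ) * (Zq : ℝ) ^ 2 ≤ (B : ℝ) := by
    calc (c : ℝ) * (Zq : ℝ) ^ 2 ≤ (c : ℝ) * (Real.sqrt B / Real.sqrt c) ^ 2 := by
          apply mul_le_mul_of_nonneg_left _ hc0.le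
          exact pow_le_pow_left₀ hZq0 hZq_le 2
      _ = (B : ℝ) := by
          rw [div_pow, Real.sq_sqrt (Nat.cast_nonneg _), Real.sq_sqrt hc0.le, mul_div_assoc']
          exact mul_div_cancel_left₀ _ hc0.ne'
  have : ((c : ℤ) : ℝ) * (Zq : ℝ) ^ 2 ≤ ((B : ℤ) : ℝ) := by push_cast; exact hreal
  have hint : (c : ℤ) * Zq ^ 2 ≤ (B : ℤ) := by exact_mod_cast this
  simpa [primPart, hZq, hg] using hint

/-! ### Peyre's constant -/

/-- The prime factors of the modulus `M` are exactly `primeSet`. [folklore] -/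
theorem primeFactors_modulus {a b c : ℕ} (habc : a * b * c ≠ 0) :
    (modulus a b c).primeFactors = primeSet a b c := by
  ext p
  rw [Nat.mem_primeFactors]
  constructor
  · rintro ⟨hp, hdvd, -⟩
    exact dvd_modulus_imp hp hdvd
  · intro hp
    exact ⟨((mem_primeSet habc).1 hp).1, (dvd_pow_self p two_ne_zero).trans (sq_dvd_modulus hp),
      modulus_ne_zero⟩

/-- `M = ∏_{p ∈ primeSet} p²` as a real number. [folklore] -/
theorem cast_modulus (a b c : ℕ) :
    ((modulus a b c : ℕ) : ℝ) = ∏ p ∈ primeSet a b c, (p : ℝ) ^ 2 := by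
  rw [modulus, Finset.prod_coe_sort (primeSet a b c) (fun p : ℕ => p ^ 2)]
  push_cast
  rfl

/-- `primeSet ∖ {2}` is the set of odd primes dividing `abc`. [folklore] -/
theorem primeSet_erase_two {a b c : ℕ} (habc : a * b * c ≠ 0) :
    (primeSet a b c).erase 2 = (a * b * c).primeFactors.erase 2 := by
  rw [primeSet, Nat.primeFactors_mul two_ne_zero habc, Nat.Prime.primeFactors Nat.prime_two]
  ext p
  simp only [Finset.mem_erase, Finset.mem_union, Finset.mem_singleton]
  tauto

/-- The per-prime identity `2p²(p - 1) = (2/(p+1)) · p⁴ · (1 - p⁻²)`. [folklore] -/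
theorem local_factor_identity {p : ℝ} (hp : 1 < p) :
    2 * p ^ 2 * (p - 1) = 2 / (p + 1) * (p ^ 2) ^ 2 * (1 - (p ^ 2)⁻¹) := by
  have h1 : p + 1 ≠ 0 := by linarith
  have h2 : p ≠ 0 := by linarith
  field_simp
  ring

/-- **Peyre's constant for the conic `C_y`.** The limit constant produced by the lattice-point
count, summed over the admissible classes and divided by the `8` sign changes, is
`π⁻¹ · bvvSummand y`. [cite: BrowningValckenborgh2012, §2.4 and (2.1)] -/
theorem peyre_constant_identity {a b c : ℕ} (hf : bvvSummand (a, b, c) ≠ 0) :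
    2 * Real.pi / Real.sqrt (4 * (a : ℝ) * (b : ℝ)) / ((modulus a b c : ℕ) : ℝ) ^ 2 *
        (6 / Real.pi ^ 2 * (∏ p ∈ (modulus a b c).primeFactors, (1 - ((p : ℝ) ^ 2)⁻¹))⁻¹) /
        Real.sqrt c *
      ((16 * ∏ p ∈ (primeSet a b c).erase 2, 2 * p ^ 2 * (p - 1) : ℕ) : ℝ) =
    8 * (Real.pi⁻¹ * bvvSummand (a, b, c)) := by
  obtain ⟨hd, -, -, -, -, -, -, -⟩ := bvvSummand_ne_zero_conditions hf
  simp only at hd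
  have habc : a * b * c ≠ 0 := hd.ne_zero
  have ha : a ≠ 0 := by rintro rfl; simp at habc
  have hb : b ≠ 0 := by rintro rfl; simp at habc
  have hc : c ≠ 0 := by rintro rfl; simp at habc
  rw [bvvSummand_eq_closed hf]
  simp only
  rw [primeFactors_modulus habc, cast_modulus, primeSet_erase_two habc]
  have h2S : 2 ∈ primeSet a b c := two_mem_primeSet habc
  rw [← Finset.mul_prod_erase _ _ h2S, ← Finset.mul_prod_erase _ (fun p : ℕ => 1 - ((p : ℝ) ^ 2)⁻¹) h2S,
    primeSet_erase_two habc]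
  set D := (a * b * c).primeFactors.erase 2 with hD
  have hDp : ∀ p ∈ D, (1 : ℝ) < p := fun p hp =>
    by exact_mod_cast (Nat.prime_of_mem_primeFactors (Finset.mem_of_mem_erase hp)).one_lt
  -- cast the natural-number product
  have hcast : ((16 * ∏ p ∈ D, 2 * p ^ 2 * (p - 1) : ℕ) : ℝ) =
      16 * ∏ p ∈ D, (2 * (p : ℝ) ^ 2 * ((p : ℝ) - 1)) := by
    push_cast
    congr 1
    refine Finset.prod_congr rfl fun p hp => ?_
    have hp1 : 1 ≤ p := (Nat.prime_of_mem_primeFactors (Finset.mem_of_mem_erase hp)).one_le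
    push_cast [Nat.cast_sub hp1]
    ring
  rw [hcast]
  -- rewrite the product `∏ 2p²(p-1)` through the per-prime identity
  have hprod : ∏ p ∈ D, (2 * (p : ℝ) ^ 2 * ((p : ℝ) - 1)) =
      (∏ p ∈ D, (2 / ((p : ℝ) + 1))) * (∏ p ∈ D, (p : ℝ) ^ 2) ^ 2 *
        ∏ p ∈ D, (1 - ((p : ℝ) ^ 2)⁻¹) := by
    rw [← Finset.prod_pow, ← Finset.prod_mul_distrib, ← Finset.prod_mul_distrib]
    exact Finset.prod_congr rfl fun p hp => local_factor_identity (hDp p hp)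
  rw [hprod]
  -- positivity of the blocks
  have hX : 0 < ∏ p ∈ D, (p : ℝ) ^ 2 :=
    Finset.prod_pos fun p hp => by have := hDp p hp; positivity
  have hY : 0 < ∏ p ∈ D, (1 - ((p : ℝ) ^ 2)⁻¹) := by
    refine Finset.prod_pos fun p hp => ?_
    have h1 := hDp p hp
    have : ((p : ℝ) ^ 2)⁻¹ < 1 := by
      rw [inv_lt_one_iff₀]; right; nlinarith
    linarith
  have hπ : Real.pi ≠ 0 := Real.pi_ne_zero
  have hab : (0 : ℝ) < (a : ℝ) * b := by
    have : (0 : ℝ) < a := by exact_mod_cast Nat.pos_of_ne_zero ha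
    have : (0 : ℝ) < b := by exact_mod_cast Nat.pos_of_ne_zero hb
    positivity
  have hc0 : (0 : ℝ) < c := by exact_mod_cast Nat.pos_of_ne_zero hc
  have hs4 : Real.sqrt (4 * (a : ℝ) * b) = 2 * Real.sqrt ((a : ℝ) * b) := by
    rw [show (4 : ℝ) * a * b = 2 ^ 2 * ((a : ℝ) * b) by ring, Real.sqrt_mul (by norm_num),
      Real.sqrt_sq (by norm_num)]
  have hrpow : ((a * b * c : ℕ) : ℝ) ^ (-(1 / 2 : ℝ)) = (Real.sqrt ((a : ℝ) * b) * Real.sqrt c)⁻¹ := by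
    rw [Real.rpow_neg (Nat.cast_nonneg _), ← Real.sqrt_eq_rpow, ← Real.sqrt_mul hab.le]
    push_cast
    ring_nf
  rw [hs4, hrpow]
  have hsab : 0 < Real.sqrt ((a : ℝ) * b) := Real.sqrt_pos.2 hab
  have hsc : 0 < Real.sqrt (c : ℝ) := Real.sqrt_pos.2 hc0
  have h22 : ((2 : ℕ) : ℝ) = 2 := by norm_num
  simp only [h22]
  set X := ∏ p ∈ D, (p : ℝ) ^ 2 with hXdef
  set Y := ∏ p ∈ D, (1 - ((p : ℝ) ^ 2)⁻¹) with hYdef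
  set T := ∏ p ∈ D, (2 / ((p : ℝ) + 1)) with hTdef
  have hXne : X ≠ 0 := hX.ne'
  have hYne : Y ≠ 0 := hY.ne'
  field_simp
  ring





/-! ### Small conversions -/

/-- Jacobi-symbol conditions at the odd prime factors give Legendre-symbol conditions.
[folklore] -/
theorem legendre_of_jacobi_cond {n : ℕ} {m : ℤ} (hn : n ≠ 0)
    (h : ∀ p ∈ n.primeFactors.erase 2, jacobiSym m p = 1) :
    ∀ p : ℕ, p.Prime → p ∣ n → p ≠ 2 → ∃ _ : Fact p.Prime, legendreSym p m = 1 := by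
  intro p hp hpn hp2
  haveI : Fact p.Prime := ⟨hp⟩
  refine ⟨inferInstance, ?_⟩
  rw [jacobiSym.legendreSym.to_jacobiSym]
  exact h p (Finset.mem_erase.2 ⟨hp2, Nat.mem_primeFactors.2 ⟨hp, hpn, hn⟩⟩)

/-- `ternForm` is even. [folklore] -/
theorem ternForm_neg' (A x : ℤ × ℤ × ℤ) : ternForm A (-x) = ternForm A x := by
  have := ternForm_zsmul A (-1) x
  simpa using this

/-- The set of signed solutions is symmetric under `x ↦ -x`. [folklore] -/
theorem mem_signedSol_neg_iff (a b c B : ℕ) (x : ℤ × ℤ × ℤ) :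
    x ∈ {x : ℤ × ℤ × ℤ | ternForm ((a : ℤ), (b : ℤ), -(c : ℤ)) x = 0 ∧ content3 x = 1 ∧ x.1 ≠ 0 ∧
        x.2.1 ≠ 0 ∧ x.2.2 ≠ 0 ∧ (a : ℤ) ∣ x.1 ∧ (b : ℤ) ∣ x.2.1 ∧ (c : ℤ) ∣ x.2.2 ∧
        (c : ℤ) * x.2.2 ^ 2 ≤ B} ↔
    -x ∈ {x : ℤ × ℤ × ℤ | ternForm ((a : ℤ), (b : ℤ), -(c : ℤ)) x = 0 ∧ content3 x = 1 ∧ x.1 ≠ 0 ∧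
        x.2.1 ≠ 0 ∧ x.2.2 ≠ 0 ∧ (a : ℤ) ∣ x.1 ∧ (b : ℤ) ∣ x.2.1 ∧ (c : ℤ) ∣ x.2.2 ∧
        (c : ℤ) * x.2.2 ^ 2 ≤ B} := by
  simp only [Set.mem_setOf_eq, Prod.fst_neg, Prod.snd_neg, neg_ne_zero, dvd_neg, neg_sq,
    ternForm_neg', content3_neg]

/-- The set of primitive zeros with a vanishing coordinate is symmetric under `x ↦ -x`.
[folklore] -/
theorem mem_zeroCoord_neg_iff (a b c : ℕ) (x : ℤ × ℤ × ℤ) :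
    x ∈ {x : ℤ × ℤ × ℤ | ternForm ((a : ℤ), (b : ℤ), -(c : ℤ)) x = 0 ∧ content3 x = 1 ∧
        (x.1 = 0 ∨ x.2.1 = 0 ∨ x.2.2 = 0)} ↔
    -x ∈ {x : ℤ × ℤ × ℤ | ternForm ((a : ℤ), (b : ℤ), -(c : ℤ)) x = 0 ∧ content3 x = 1 ∧
        (x.1 = 0 ∨ x.2.1 = 0 ∨ x.2.2 = 0)} := by
  simp only [Set.mem_setOf_eq, Prod.fst_neg, Prod.snd_neg, neg_eq_zero, ternForm_neg', content3_neg]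

/-- Reading a congruence `z ≡ ξ.val (mod n)` in `ZMod n`. [folklore] -/
theorem intCast_eq_of_dvd_sub_val {n : ℕ} [NeZero n] {z : ℤ} {ξ : ZMod n}
    (h : (n : ℤ) ∣ z - (ξ.val : ℤ)) : (z : ZMod n) = ξ := by
  have e : ((ξ.val : ℤ) : ZMod n) = ((z : ℤ) : ZMod n) :=
    (ZMod.intCast_eq_intCast_iff_dvd_sub _ _ _).2 h
  rw [← e, Int.cast_natCast, ZMod.natCast_zmod_val]

/-! ### The per-conic lower bound -/

/-- **The asymptotic lower bound on each conic** (Browning–Van Valckenborgh 2012, Theorem 1 via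
§3): for `μ²(y₀y₁y₂) = 1` and every `ε > 0`,
`#conicTriples y B ≥ (π⁻¹ · bvvSummand y - ε) √B` for all large `B`.
[cite: BrowningValckenborgh2012, Theorem 1, §§2–3] -/
theorem conic_lower_bound (y : ℕ × ℕ × ℕ) (_hy : Squarefree (y.1 * y.2.1 * y.2.2)) (ε : ℝ)
    (hε : 0 < ε) :
    ∀ᶠ B : ℕ in atTop, (Real.pi⁻¹ * bvvSummand y - ε) * Real.sqrt B ≤
      ((conicTriples y B).ncard : ℝ) := by
  classical
  by_cases hf : bvvSummand y = 0
  · refine Filter.Eventually.of_forall fun B => ?_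
    rw [hf, mul_zero, zero_sub]
    have h1 : 0 ≤ Real.sqrt (B : ℝ) := Real.sqrt_nonneg _
    have h2 : (0 : ℝ) ≤ ((conicTriples y B).ncard : ℝ) := Nat.cast_nonneg _
    nlinarith
  obtain ⟨hd, -, hja, hjb, hjc, h8a, h8b, h8c⟩ := bvvSummand_ne_zero_conditions hf
  obtain ⟨a, b, c⟩ := y
  simp only at hd hja hjb hjc h8a h8b h8c hf ⊢
  have habc : a * b * c ≠ 0 := hd.ne_zero
  have ha : a ≠ 0 := by rintro rfl; simp at habc
  have hb : b ≠ 0 := by rintro rfl; simp at habc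
  have hc : c ≠ 0 := by rintro rfl; simp at habc
  have hA0 : (coeffs a b c).1 ≠ 0 := by simp [coeffs, ha]
  have hA1 : (coeffs a b c).2.1 ≠ 0 := by simp [coeffs, hb]
  have hA2 : (coeffs a b c).2.2 ≠ 0 := by simp [coeffs, hc]
  have hA0' : 0 < (coeffs a b c).1 := by
    simp only [coeffs]; exact_mod_cast Nat.pos_of_ne_zero ha
  have hA1' : 0 < (coeffs a b c).2.1 := by
    simp only [coeffs]; exact_mod_cast Nat.pos_of_ne_zero hb
  have hc0 : (0 : ℝ) < c := by exact_mod_cast Nat.pos_of_ne_zero hc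
  have hsc : 0 < Real.sqrt (c : ℝ) := Real.sqrt_pos.2 hc0
  -- (A) base point and unimodular basis
  obtain ⟨P, hP, hPc, hγ⟩ := exists_primitive_zero hd (legendre_of_jacobi_cond ha hja)
    (legendre_of_jacobi_cond hb hjb) (legendre_of_jacobi_cond hc hjc)
  have hP' : ternForm (coeffs a b c) P = 0 := hP
  obtain ⟨e₁, e₂, he⟩ := exists_unimodular_completion hPc
  -- (B) the height form `Z(s e₁ + t e₂) = qA s² + qB st + qC t²`
  have hcoef := zForm_coeff_pos hP' he hA0' hA1' hγ
  have hdisc := zForm_disc hP' he hγ.ne'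
  have hzeq := fun s t => zForm_eq (coeffs a b c) P e₁ e₂ s t
  generalize hqA : (conicMap (coeffs a b c) P ((1 : ℤ) • e₁ + (0 : ℤ) • e₂)).2.2 = qA
    at hcoef hdisc hzeq
  generalize hqC : (conicMap (coeffs a b c) P ((0 : ℤ) • e₁ + (1 : ℤ) • e₂)).2.2 = qC
    at hdisc hzeq
  generalize hq11 : (conicMap (coeffs a b c) P ((1 : ℤ) • e₁ + (1 : ℤ) • e₂)).2.2 = q11
    at hdisc hzeq
  simp only [coeffs] at hdisc
  obtain ⟨Q, hQ⟩ : ∃ Q : (Fin 2 → ℝ) → ℝ, ∀ x, Q x = (qA : ℝ) * x 0 ^ 2 +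
      ((q11 - qA - qC : ℤ) : ℝ) * (x 0 * x 1) + (qC : ℝ) * x 1 ^ 2 := ⟨_, fun x => rfl⟩
  have hAQ : (0 : ℝ) < (qA : ℝ) := by exact_mod_cast hcoef
  have hDQ' : 4 * (qA : ℝ) * (qC : ℝ) - ((q11 - qA - qC : ℤ) : ℝ) ^ 2 = 4 * (a : ℝ) * (b : ℝ) := by
    have : (4 * qA * qC - (q11 - qA - qC) ^ 2 : ℤ) = 4 * a * b := by linear_combination -hdisc
    have h' : ((4 * qA * qC - (q11 - qA - qC) ^ 2 : ℤ) : ℝ) = ((4 * a * b : ℤ) : ℝ) := by rw [this]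
    push_cast at h' ⊢
    linarith
  have hDQ : (0 : ℝ) < 4 * (qA : ℝ) * (qC : ℝ) - ((q11 - qA - qC : ℤ) : ℝ) ^ 2 := by
    rw [hDQ']
    have : (0 : ℝ) < a := by exact_mod_cast Nat.pos_of_ne_zero ha
    have : (0 : ℝ) < b := by exact_mod_cast Nat.pos_of_ne_zero hb
    positivity
  have hQint : ∀ z : Fin 2 → ℤ,
      Q (intPt z) = ((conicMap (coeffs a b c) P ((z 0) • e₁ + (z 1) • e₂)).2.2 : ℝ) := by
    intro z
    rw [hzeq (z 0) (z 1), hQ]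
    simp only [intPt_apply]
    push_cast
    ring
  -- (C) classes, representatives, pieces
  haveI : NeZero (modulus a b c) := ⟨modulus_ne_zero⟩
  have hM0 : 0 < modulus a b c := modulus_pos
  set r : ZMod (modulus a b c) × ZMod (modulus a b c) → (Fin 2 → ℤ) :=
    fun ξ => ![((ξ.1.val : ℕ) : ℤ), ((ξ.2.val : ℕ) : ℤ)] with hr
  have hr0 : ∀ ξ, r ξ 0 = (ξ.1.val : ℤ) := fun ξ => by simp [hr]
  have hr1 : ∀ ξ, r ξ 1 = (ξ.2.val : ℤ) := fun ξ => by simp [hr]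
  set piece : ZMod (modulus a b c) × ZMod (modulus a b c) → ℕ → Set (Fin 2 → ℤ) := fun ξ B =>
    {z | (∀ i, ((modulus a b c : ℕ) : ℤ) ∣ z i - r ξ i) ∧ Int.gcd (z 0) (z 1) = 1 ∧
      Q (intPt z) ≤ (globalWeight a b c P e₁ e₂ ξ : ℝ) / Real.sqrt c * Real.sqrt B} with hpiece
  set Adm := (Finset.univ : Finset (ZMod (modulus a b c) × ZMod (modulus a b c))).filter
    (fun ξ => globalWeight a b c P e₁ e₂ ξ ≠ 0) with hAdm
  set κ₀ : ℝ := 2 * Real.pi / Real.sqrt (4 * (a : ℝ) * (b : ℝ)) / ((modulus a b c : ℕ) : ℝ) ^ 2 *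
    (6 / Real.pi ^ 2 * (∏ p ∈ (modulus a b c).primeFactors, (1 - ((p : ℝ) ^ 2)⁻¹))⁻¹) with hκ₀
  -- (D) per-class asymptotics from the lattice-point engine
  have hclass : ∀ ξ ∈ Adm, Tendsto (fun B : ℕ => ((piece ξ B).ncard : ℝ) / Real.sqrt B) atTop
      (𝓝 (κ₀ * ((globalWeight a b c P e₁ e₂ ξ : ℝ) / Real.sqrt c))) := by
    intro ξ hξ
    have hWξ : globalWeight a b c P e₁ e₂ ξ ≠ 0 := (Finset.mem_filter.1 hξ).2
    have hcop : Nat.Coprime (Int.gcd (r ξ 0) (r ξ 1)) (modulus a b c) := by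
      rw [hr0, hr1]; exact coprime_of_globalWeight_ne_zero P e₁ e₂ hWξ
    have heng := tendsto_ncard_coprime_congr_binQF_le_div hQ hAQ hDQ hM0 hcop
    rw [hDQ', Literature.NumberTheory.LFunctions.tsum_moebius_div_sq_coprime hM0] at heng
    have hwpos : 0 < (globalWeight a b c P e₁ e₂ ξ : ℝ) / Real.sqrt c := by
      have : (0 : ℝ) < globalWeight a b c P e₁ e₂ ξ := by exact_mod_cast Nat.pos_of_ne_zero hWξ
      positivity
    have := tendsto_div_sqrt_of_tendsto_div
      (N := fun T : ℝ => (({z : Fin 2 → ℤ | (∀ i, ((modulus a b c : ℕ) : ℤ) ∣ z i - r ξ i) ∧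
        Int.gcd (z 0) (z 1) = 1 ∧ Q (intPt z) ≤ T}.ncard : ℕ) : ℝ)) hwpos heng
    simpa only [hpiece, hκ₀] using this
  -- (E) the summed asymptotic and its constant
  have hsumlim : Tendsto (fun B : ℕ => (∑ ξ ∈ Adm, ((piece ξ B).ncard : ℝ)) / Real.sqrt B) atTop
      (𝓝 (∑ ξ ∈ Adm, κ₀ * ((globalWeight a b c P e₁ e₂ ξ : ℝ) / Real.sqrt c))) := by
    simp only [Finset.sum_div]
    exact tendsto_finsetSum _ hclass
  have hsumW : ∑ ξ ∈ Adm, (globalWeight a b c P e₁ e₂ ξ : ℝ) =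
      ((16 * ∏ p ∈ (primeSet a b c).erase 2, 2 * p ^ 2 * (p - 1) : ℕ) : ℝ) := by
    rw [← sum_globalWeight_eq hd hP' hPc he, Nat.cast_sum, hAdm, Finset.sum_filter]
    refine Finset.sum_congr rfl fun ξ _ => ?_
    by_cases h : globalWeight a b c P e₁ e₂ ξ = 0 <;> simp [h]
  have hconst : ∑ ξ ∈ Adm, κ₀ * ((globalWeight a b c P e₁ e₂ ξ : ℝ) / Real.sqrt c) =
      8 * (Real.pi⁻¹ * bvvSummand (a, b, c)) := by
    rw [← Finset.mul_sum, ← Finset.sum_div, hsumW, ← peyre_constant_identity hf, hκ₀]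
    ring
  rw [hconst] at hsumlim
  -- (F) the exceptional set (primitive zeros with a vanishing coordinate) and its preimage
  set F0 : Set (ℤ × ℤ × ℤ) := {x | ternForm ((a : ℤ), (b : ℤ), -(c : ℤ)) x = 0 ∧ content3 x = 1 ∧
    (x.1 = 0 ∨ x.2.1 = 0 ∨ x.2.2 = 0)} with hF0
  set Fv : Set (ℤ × ℤ) := {v | Int.gcd v.1 v.2 = 1 ∧
    primPart (conicMap (coeffs a b c) P (v.1 • e₁ + v.2 • e₂)) ∈ F0} with hFv
  have hFvfin : Fv.Finite :=
    finite_coprime_preimage_param hA0 hA1 hA2 hP' he (finite_primitive_zero_coord_eq_zero hd)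
  -- (G) the combinatorial inequality `∑_ξ #piece ξ B ≤ 8 #conicTriples + #Fv`
  set f : (Fin 2 → ℤ) → ℤ × ℤ := fun z => (z 0, z 1) with hfdef
  have hfinj : Function.Injective f := by
    intro z w h
    simp only [hfdef, Prod.mk.injEq] at h
    funext i
    fin_cases i
    · exact h.1
    · exact h.2
  have hineqN : ∀ B : ℕ, ∑ ξ ∈ Adm, (piece ξ B).ncard ≤
      8 * (conicTriples (a, b, c) B).ncard + Fv.ncard := by
    intro B
    set SB : Set (ℤ × ℤ × ℤ) := {x | ternForm ((a : ℤ), (b : ℤ), -(c : ℤ)) x = 0 ∧ content3 x = 1 ∧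
      x.1 ≠ 0 ∧ x.2.1 ≠ 0 ∧ x.2.2 ≠ 0 ∧ (a : ℤ) ∣ x.1 ∧ (b : ℤ) ∣ x.2.1 ∧ (c : ℤ) ∣ x.2.2 ∧
      (c : ℤ) * x.2.2 ^ 2 ≤ B} with hSB
    set Sv : Set (ℤ × ℤ) := {v | Int.gcd v.1 v.2 = 1 ∧
      primPart (conicMap (coeffs a b c) P (v.1 • e₁ + v.2 • e₂)) ∈ SB} with hSv
    have hSvcard : Sv.ncard = 8 * (conicTriples (a, b, c) B).ncard := by
      rw [hSv, ncard_param_eq hA0 hA1 hA2 hP' hPc he (S := SB) (fun x hx => ⟨hx.1, hx.2.1⟩)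
        (fun x => mem_signedSol_neg_iff a b c B x), hSB, ncard_signedSolutions hd B]
    have hSvfin : Sv.Finite :=
      finite_coprime_preimage_param hA0 hA1 hA2 hP' he (finite_signedSolutions hd B)
    have hUfin : (Sv ∪ Fv).Finite := hSvfin.union hFvfin
    have hTfin : (f ⁻¹' (Sv ∪ Fv)).Finite := hUfin.preimage hfinj.injOn
    have hsub : ∀ ξ ∈ Adm, piece ξ B ⊆ f ⁻¹' (Sv ∪ Fv) := by
      intro ξ hξ z hz
      obtain ⟨hcong, hgcd, hQz⟩ := hz
      have hWξ : globalWeight a b c P e₁ e₂ ξ ≠ 0 := (Finset.mem_filter.1 hξ).2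
      have h1 : ((z 0 : ℤ) : ZMod (modulus a b c)) = ξ.1 :=
        intCast_eq_of_dvd_sub_val (by have := hcong 0; rwa [hr0] at this)
      have h2 : ((z 1 : ℤ) : ZMod (modulus a b c)) = ξ.2 :=
        intCast_eq_of_dvd_sub_val (by have := hcong 1; rwa [hr1] at this)
      have hWint : intWeight a b c P e₁ e₂ (z 0, z 1) = globalWeight a b c P e₁ e₂ ξ := by
        rw [← globalWeight_intCast P e₁ e₂ (z 0, z 1)]
        simp only [h1, h2, Prod.mk.eta]
      have hWne : intWeight a b c P e₁ e₂ (z 0, z 1) ≠ 0 := by rw [hWint]; exact hWξ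
      have hbound : ((conicMap (coeffs a b c) P ((z 0, z 1).1 • e₁ + (z 0, z 1).2 • e₂)).2.2 : ℝ) ≤
          (intWeight a b c P e₁ e₂ (z 0, z 1) : ℝ) / Real.sqrt c * Real.sqrt B := by
        rw [hWint, ← hQint z]; exact hQz
      have key := param_mem_of_intWeight_ne_zero hd hP' hPc he hγ h8a h8b h8c (v := (z 0, z 1))
        hgcd hWne hbound
      rcases key with h | h
      · exact Or.inl ⟨hgcd, h⟩
      · exact Or.inr ⟨hgcd, h⟩
    have hdisj : ∀ ξ ∈ Adm, ∀ ξ' ∈ Adm, ξ ≠ ξ' → Disjoint (piece ξ B) (piece ξ' B) := by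
      intro ξ _ ξ' _ hne
      rw [Set.disjoint_left]
      intro z hz hz'
      apply hne
      have h1 : ((z 0 : ℤ) : ZMod (modulus a b c)) = ξ.1 :=
        intCast_eq_of_dvd_sub_val (by have := hz.1 0; rwa [hr0] at this)
      have h2 : ((z 1 : ℤ) : ZMod (modulus a b c)) = ξ.2 :=
        intCast_eq_of_dvd_sub_val (by have := hz.1 1; rwa [hr1] at this)
      have h1' : ((z 0 : ℤ) : ZMod (modulus a b c)) = ξ'.1 :=
        intCast_eq_of_dvd_sub_val (by have := hz'.1 0; rwa [hr0] at this)
      have h2' : ((z 1 : ℤ) : ZMod (modulus a b c)) = ξ'.2 :=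
        intCast_eq_of_dvd_sub_val (by have := hz'.1 1; rwa [hr1] at this)
      exact Prod.ext (h1.symm.trans h1') (h2.symm.trans h2')
    calc ∑ ξ ∈ Adm, (piece ξ B).ncard ≤ (f ⁻¹' (Sv ∪ Fv)).ncard :=
          sum_ncard_le_of_disjoint Adm (fun ξ => piece ξ B) hdisj hTfin hsub
      _ ≤ (Sv ∪ Fv).ncard := Set.ncard_le_ncard_of_injOn f (fun z hz => hz) hfinj.injOn hUfin
      _ ≤ Sv.ncard + Fv.ncard := Set.ncard_union_le _ _
      _ = 8 * (conicTriples (a, b, c) B).ncard + Fv.ncard := by rw [hSvcard]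
  have hineq : ∀ B : ℕ, (∑ ξ ∈ Adm, ((piece ξ B).ncard : ℝ)) ≤
      8 * ((conicTriples (a, b, c) B).ncard : ℝ) + (Fv.ncard : ℝ) := by
    intro B
    have := hineqN B
    exact_mod_cast this
  -- (H) conclusion
  exact eventually_lower_bound (Fv.ncard : ℝ) hsumlim hineq hε

/-- **Theorem 1 of Browning–Van Valckenborgh (2012), lower bound**: `SquarefulSumLowerBound`
holds. The proof follows §3 of the paper (reduction to the conics `y₀³x₀² + y₁³x₁² = y₂³x₂²`
with `μ²(y₀y₁y₂) = 1`) with the asymptotic count on each conic obtained from an explicit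
parametrisation of its primitive integral points and lattice-point counting in ellipses, in
place of the Fouvry–Manin–Tschinkel/Peyre black box quoted there.
[cite: BrowningValckenborgh2012, Theorem 1 and (1.1)] -/
theorem SquarefulSumLowerBound_holds : SquarefulSumLowerBound :=
  squarefulSumLowerBound_of_conic fun y hy ε hε => conic_lower_bound y hy ε hε


end Literature.NumberTheory.DiophantineGeometry
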